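import Summits.ResolutionOfSingularities.ResolutionOfSingularities.Theses.IndSmooth
import Summits.ResolutionOfSingularities.ResolutionOfSingularities.Theses.FrobeniusClosing
import Literature.AlgebraicGeometry.Resolution.ZariskiPatchingProperModels
import Literature.AlgebraicGeometry.Resolution.ProperModels
import Mathlib.RingTheory.EssentialFiniteness
import HarnessLib

/-!
# Crux `CleanCovers.CoverResolution` (stmt-ResolutionOfSingularities-15104), line `strategy-split`:
# the patching stubs of v2.1 and v2.2 compared

Route `ResolutionOfSingularities/CleanCovers`, line lead continuation seat c2 (2026-08-17),
certificate pair of the reshape v2.1 → v2.2 of the skeleton `Lines/strategy_split.lean`.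

Version v2.1 of the line carried the free-floating patching stub **T** = Zariski's two-model
patching of PROPER models over perfect fields of characteristic `p` (Piltant 2013, Prop. 5.1 with
`P = P_reg`, whose output in Step 5 of the proof is a proper model; `ProperModel`, `Hom.RegLe` of
`Literature/AlgebraicGeometry/Resolution/ProperModels.lean`): any two proper models `M₁, M₂` of a
finitely generated `K/k` are dominated by a third `N` with `φᵢ⁻¹(Reg Mᵢ) ⊆ Reg N`. Version v2.2
replaces T by the EXISTING sibling crux `FrobeniusClosing.PatchingRelPerfect`
(stmt-ResolutionOfSingularities-16161). This file certifies that the replacement is a WEAKENING of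
the stub:

* `patchingPerfect_of_twoModelPatchingPerfect` — **T ⇒ `IndSmooth.PatchingPerfect`**
  (stmt-ResolutionOfSingularities-16089, Zariski patching over ONE perfect field: relative local
  uniformization over `k` ⇒ weak resolution of every reduced separated `k`-scheme of finite type),
  by the tree's proved reduction "two-model patching of proper models over `k` + relative LU over
  `k` ⇒ weak resolution over `k` in every dimension"
  (`Literature.AlgebraicGeometry.Resolution.resolutionOverUpToDim_of_properPatching_of_relLU`,
  with `exists_topologicalKrullDim_le_of_locallyOfFiniteType`); the proof is that of
  `resolutionInChar_of_properTwoModelPatching_of_relLU` with `[PerfectField k]` carried along.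
* `patchingRelPerfect_of_indSmoothPatchingPerfect` — **`IndSmooth.PatchingPerfect` ⇒
  `FrobeniusClosing.PatchingRelPerfect`**: the fibrewise crux (for each perfect `k`: LU over `k` ⇒
  resolution over `k`) implies the uniform one (LU over all perfect fields of characteristic `p` ⇒
  resolution over all of them) — instantiate the uniform antecedent at the ground field. Pure
  logic. (The same implication with the verbatim-equal route copy `AbhyankarShadows.PatchingPerfect`
  as antecedent is `Theorems.patchingRelPerfect_of_patchingPerfect` of
  `Theorems/IndSmoothPatchingPerfectOfAtomDimFour.lean`; the name differs to keep one
  fully-qualified name per module.)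
* `patchingRelPerfect_of_twoModelPatchingPerfect` — **T ⇒ `FrobeniusClosing.PatchingRelPerfect`**,
  the composite: the v2.2 patching stub is implied by the v2.1 patching stub.

Universe: everything at `Type` (= `Type 0`), as in the route items; the Literature theorems are
universe-polymorphic and specialise. No named fact is taken as a hypothesis beyond the displayed
antecedents; no `sorry`.

References: O. Piltant, *An axiomatic version of Zariski's patching theorem*, RACSAM 107 (2013)
91–121, Prop. 5.1 and Cor. 5.7 [Piltant2013]; O. Zariski, *Reduction of the singularities of
algebraic three dimensional varieties*, Ann. of Math. 45 (1944), Fundamental Theorem p. 539.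
-/

set_option linter.dupNamespace false -- mandated namespace of this single-conjunct summit

noncomputable section

namespace Summit.ResolutionOfSingularities.ResolutionOfSingularities.Theorems

open CategoryTheory AlgebraicGeometry TopologicalSpace
open Literature.AlgebraicGeometry.Resolution

/-- **T ⇒ `PatchingPerfect`** (stmt-ResolutionOfSingularities-16089): two-model patching of
proper models over perfect fields of characteristic `p` implies Zariski patching over every
perfect field of characteristic `p` — given relative local uniformization over the perfect field
`k`, every reduced separated `k`-scheme of finite type has a resolution. Proof: bound the
dimension (`exists_topologicalKrullDim_le_of_locallyOfFiniteType`), reshape the relative LU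
hypothesis of the item (finitely generated `K/k`, `k ⊆ O`, arbitrary finitely generated `R ⊆ O`)
into the engine's form (`R` an affine model of `K/k` inside `O`), and run the tree's
Zariski–Piltant engine `resolutionOverUpToDim_of_properPatching_of_relLU` over `k` (components,
Chow, projective closure, a finite resolving system of proper models from LU and the
quasi-compactness of the Zariski–Riemann space, patched two at a time).
[cite: Piltant2013, Prop. 5.1 and Cor. 5.7] -/
theorem patchingPerfect_of_twoModelPatchingPerfect : (∀ p : ℕ, p.Prime → ∀ (k : Type) [Field k] [CharP k p] [PerfectField k] (K : Type) [Field K] [Algebra k K] [Algebra.EssFiniteType k K] (M₁ M₂ : Literature.AlgebraicGeometry.Resolution.ProperModel k K), ∃ (N : Literature.AlgebraicGeometry.Resolution.ProperModel k K) (φ₁ : N.Hom M₁) (φ₂ : N.Hom M₂), φ₁.RegLe ∧ φ₂.RegLe) → Summit.ResolutionOfSingularities.ResolutionOfSingularities.Theses.IndSmooth.PatchingPerfect := by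
  intro hT p hp k _ _ _ hLU X f hs hl hq hr
  haveI : QuasiCompact f := hq
  haveI : LocallyOfFiniteType f := hl
  haveI : CompactSpace X := QuasiCompact.compactSpace_of_compactSpace f
  obtain ⟨d, hd⟩ := exists_topologicalKrullDim_le_of_locallyOfFiniteType f
  -- the item's relative LU over `k`, reshaped into the engine's form
  have hLU' : ∀ (K : Type) [Field K] [Algebra k K] (O : ValuationSubring K) (R : Subalgebra k K),
      R.FG → IsFractionRing R K → R.toSubring ≤ O.toSubring →
        ∃ (A : Subalgebra k K) (h : A.toSubring ≤ O.toSubring), R ≤ A ∧ A.FG ∧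
          IsRegularLocalRing (Localization.AtPrime
            (Ideal.comap (Subring.inclusion h) (IsLocalRing.maximalIdeal O))) := by
    intro K _ _ O R hRfg hRfr hRO
    haveI : Algebra.FiniteType k R := R.fg_iff_finiteType.mp hRfg
    haveI : Algebra.EssFiniteType R K :=
      Algebra.EssFiniteType.of_isLocalization K (nonZeroDivisors R)
    have hKfg : (⊤ : IntermediateField k K).FG :=
      IntermediateField.fg_top_iff.mpr (Algebra.EssFiniteType.comp k R K)
    obtain ⟨A, h, hle, hAfg, -, hreg⟩ :=
      hLU K hKfg O (fun c => hRO (R.algebraMap_mem c)) R hRfg hRO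
    exact ⟨A, h, hle, hAfg, hreg⟩
  exact resolutionOverUpToDim_of_properPatching_of_relLU (hT p hp k) hLU' d X f hs hl hq hr hd

/-- **`IndSmooth.PatchingPerfect` ⇒ `FrobeniusClosing.PatchingRelPerfect`**
(stmt-ResolutionOfSingularities-16089 ⇒ stmt-ResolutionOfSingularities-16161): the fibrewise crux
(for each perfect `k` of characteristic `p`: relative LU over `k` ⇒ resolution over `k`) implies
the uniform sibling crux (relative LU over ALL perfect fields of characteristic `p` ⇒ resolution
over all of them) — instantiate the uniform antecedent at the ground field. Pure logic (binder
bookkeeping). [folklore] -/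
theorem patchingRelPerfect_of_indSmoothPatchingPerfect : Summit.ResolutionOfSingularities.ResolutionOfSingularities.Theses.IndSmooth.PatchingPerfect → Summit.ResolutionOfSingularities.ResolutionOfSingularities.Theses.FrobeniusClosing.PatchingRelPerfect :=
  fun hPP p hp hLU k _ _ _ X f hs hl hq hr => hPP p hp k (fun K _ _ => hLU k K) X f hs hl hq hr

/-- **T ⇒ `FrobeniusClosing.PatchingRelPerfect`** (stmt-ResolutionOfSingularities-16161): the
patching stub of v2.2 of line `strategy-split` (the sibling crux verbatim) is implied by the
patching stub T of v2.1 (two-model patching of proper models over perfect fields) — the composite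
of `patchingPerfect_of_twoModelPatchingPerfect` and
`patchingRelPerfect_of_indSmoothPatchingPerfect`. [folklore] -/
theorem patchingRelPerfect_of_twoModelPatchingPerfect : (∀ p : ℕ, p.Prime → ∀ (k : Type) [Field k] [CharP k p] [PerfectField k] (K : Type) [Field K] [Algebra k K] [Algebra.EssFiniteType k K] (M₁ M₂ : Literature.AlgebraicGeometry.Resolution.ProperModel k K), ∃ (N : Literature.AlgebraicGeometry.Resolution.ProperModel k K) (φ₁ : N.Hom M₁) (φ₂ : N.Hom M₂), φ₁.RegLe ∧ φ₂.RegLe) → Summit.ResolutionOfSingularities.ResolutionOfSingularities.Theses.FrobeniusClosing.PatchingRelPerfect :=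
  fun hT => patchingRelPerfect_of_indSmoothPatchingPerfect (patchingPerfect_of_twoModelPatchingPerfect hT)

end Summit.ResolutionOfSingularities.ResolutionOfSingularities.Theorems

end
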